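import Summits.Parity.GeneralizedHardyLittlewood.Theorems.PrimeLevelFamEdgeMomentsBeyondDiagonalDiagDecorPrime
import HarnessLib

/-!
# Route `PrimeLevelFamEdge`, crux K_A `MomentsBeyondDiagonal` (stmt-Parity-20007), line «petersson_layers» v4, stub `stub_diag`:
# **the DOUBLE prime peel of the `P₂²`-decoration: `Σ_k a_n(k)G(k)P₂(k)² = Σ_p log⁴p·a_n(p)·Σ_{k′}a_{np}(k′)G(pk′)
# + Σ_p log²p·a_n(p)·Σ_{k′}a_{np}(k′)G(pk′)P₂(k′)`** (`P_m(k) = Σ_{p∣k}log^m p`)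

Algebraic brick of the `M₄ = τ(3P₂² − 2P₄)`-engine asked for by rung 2 of `stub_diag` (`…DiagRungTwoOfM4`; census note in
`…DiagDecorOrderTwoTwoAssembly`): peeling ONE prime from `P₂(k)² = P₂(k)·Σ_{p∣k}log²p` with
`…DiagDecorPrime.sum_copTauW_mul_mul_sum_primeFactors_eq` (weight `G·P₂`, `g(p) = log²p`) and splitting
`P₂(pk′) = log²p + P₂(k′)` on the support of `a_{np}(k′)` (`p ∤ k′`) gives the `P₄`-peel (first sum; its asymptotic is
`…DiagDecorPrimePowTwo.abs_coprimeSumPow_primePow_add_le_of_two_le` with `i = 3` after `…DiagDecorPrimePowTerm`) plus the CROSS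
term (second sum), whose inner sums are the `P₂`-decorated coprime sums of `…DiagDecorPrimeSq` at modulus `np`:

* `primePowSum_prime_mul` — `P_m(pk) = log^m p + P_m(k)` for a prime `p ∤ k`, `k ≠ 0`;
* `copTauW_mul_primePowSum_prime_mul` — `a_{np}(k)·P_m(pk) = a_{np}(k)·(log^m p + P_m(k))` for every `k` (both sides vanish
  when `p ∣ k`);
* `sum_copTauW_mul_primeSq_sq_eq` — **the displayed double-peel decomposition** (any `n, N`, weight `G`, and any power `m`:
  `P_m(k)·P_m(k)` splits as the `P_{2m}`-peel plus the cross term).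

Def-free; theorems only. Helper `--supports stmt-Parity-20007`; closes nothing; K_A, K_B and the Parity summit are NOT proved;
nothing about Landau–Siegel zeros.

## References
* E. Kowalski, P. Michel, J. VanderKam, J. reine angew. Math. 526 (2000), (23)–(28) pp. 13–15.
  [cite: KowalskiMichelVanderKam2000, (23)–(28) — derivation (prime decorations → prime sums)]
-/

noncomputable section

open scoped Real
open Finset ArithmeticFunction

namespace Summit.Parity.GeneralizedHardyLittlewood.Theorems.MomentsBeyondDiagonal.DiagLines

open Literature.NumberTheory.LFunctions.KMV2000
open Summit.Parity.GeneralizedHardyLittlewood.Theorems.BeyondDiagonalBeatsQuarter.KernelFormXSq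
  (copTauW copTauW_apply copTauW_apply_prime)

/-- `P_m(pk) = log^m p + P_m(k)` for a prime `p ∤ k`, `k ≠ 0` (`P_m(k) = Σ_{q∣k}log^m q`). [folklore] -/
theorem primePowSum_prime_mul {p k : ℕ} (hp : p.Prime) (hk : k ≠ 0) (hpk : ¬ p ∣ k) (m : ℕ) :
    ∑ q ∈ (p * k).primeFactors, Real.log q ^ m = Real.log p ^ m + ∑ q ∈ k.primeFactors, Real.log q ^ m := by
  rw [Nat.primeFactors_mul hp.ne_zero hk, hp.primeFactors]
  have hdisj : Disjoint ({p} : Finset ℕ) k.primeFactors := by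
    rw [Finset.disjoint_singleton_left]
    intro h
    exact hpk (Nat.dvd_of_mem_primeFactors h)
  rw [Finset.sum_union hdisj, Finset.sum_singleton]

/-- `a_{np}(k)·P_m(pk) = a_{np}(k)·(log^m p + P_m(k))` for a prime `p` and every `n`, `k` (when `p ∣ k` the weight
`a_{np}(k) = copTauW (n*p) k` vanishes, since `(k, np) ≠ 1`). [folklore] -/
theorem copTauW_mul_primePowSum_prime_mul {p : ℕ} (hp : p.Prime) (n k m : ℕ) :
    copTauW (n * p) k * ∑ q ∈ (p * k).primeFactors, Real.log q ^ m =
      copTauW (n * p) k * (Real.log p ^ m + ∑ q ∈ k.primeFactors, Real.log q ^ m) := by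
  rcases eq_or_ne k 0 with rfl | hk
  · simp
  by_cases hpk : p ∣ k
  · have h0 : copTauW (n * p) k = 0 := by
      rw [copTauW_apply, if_neg]
      intro hcop
      have : Nat.Coprime k p := hcop.coprime_dvd_right (dvd_mul_left p n)
      exact hp.ne_one ((Nat.coprime_comm.1 this).eq_one_of_dvd hpk)
    rw [h0, zero_mul, zero_mul]
  · rw [primePowSum_prime_mul hp hk hpk m]

/-- **The double prime peel of a squared prime-power-log decoration**: for every `n, N`, weight `G` and power `m`,
`Σ_{k≤N} a_n(k)·G(k)·(P_m(k)·P_m(k)) = Σ_{p≤N prime} log^{2m}p·a_n(p)·Σ_{k′≤N/p}a_{np}(k′)G(pk′)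
  + Σ_{p≤N prime} log^m p·a_n(p)·Σ_{k′≤N/p}a_{np}(k′)G(pk′)P_m(k′)`.
[cite: KowalskiMichelVanderKam2000, (23)–(28) — derivation (prime decorations → prime sums)] -/
theorem sum_copTauW_mul_primeSq_sq_eq (n N m : ℕ) (G : ℕ → ℝ) :
    ∑ k ∈ Icc 1 N, copTauW n k * G k *
        ((∑ q ∈ k.primeFactors, Real.log q ^ m) * ∑ q ∈ k.primeFactors, Real.log q ^ m) =
      ∑ p ∈ (Icc 1 N).filter Nat.Prime, Real.log p ^ (2 * m) * copTauW n p *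
          ∑ k ∈ Icc 1 (N / p), copTauW (n * p) k * G (p * k) +
        ∑ p ∈ (Icc 1 N).filter Nat.Prime, Real.log p ^ m * copTauW n p *
          ∑ k ∈ Icc 1 (N / p), copTauW (n * p) k * (G (p * k) * ∑ q ∈ k.primeFactors, Real.log q ^ m) := by
  have h := sum_copTauW_mul_mul_sum_primeFactors_eq n N (fun k ↦ G k * ∑ q ∈ k.primeFactors, Real.log q ^ m)
    (fun p ↦ Real.log p ^ m)
  have hl : ∑ k ∈ Icc 1 N, copTauW n k * G k *
      ((∑ q ∈ k.primeFactors, Real.log q ^ m) * ∑ q ∈ k.primeFactors, Real.log q ^ m) =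
      ∑ k ∈ Icc 1 N, copTauW n k * (G k * ∑ q ∈ k.primeFactors, Real.log q ^ m) *
        ∑ p ∈ k.primeFactors, Real.log p ^ m :=
    Finset.sum_congr rfl fun k _ ↦ by ring
  rw [hl, h, ← Finset.sum_add_distrib]
  refine Finset.sum_congr rfl fun p hp ↦ ?_
  have hp' : p.Prime := (Finset.mem_filter.1 hp).2
  rw [mul_assoc (Real.log p ^ (2 * m)), mul_assoc (Real.log p ^ m) (copTauW n p), mul_assoc (Real.log p ^ m) (copTauW n p),
    Finset.mul_sum, Finset.mul_sum, Finset.mul_sum, Finset.mul_sum, Finset.mul_sum, Finset.mul_sum,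
    ← Finset.sum_add_distrib]
  refine Finset.sum_congr rfl fun k _ ↦ ?_
  have hsplit := copTauW_mul_primePowSum_prime_mul hp' n k m
  calc Real.log p ^ m * (copTauW n p * (copTauW (n * p) k * (G (p * k) * ∑ q ∈ (p * k).primeFactors, Real.log q ^ m)))
      = Real.log p ^ m * (copTauW n p * G (p * k)) *
          (copTauW (n * p) k * ∑ q ∈ (p * k).primeFactors, Real.log q ^ m) := by ring
    _ = Real.log p ^ m * (copTauW n p * G (p * k)) *
          (copTauW (n * p) k * (Real.log p ^ m + ∑ q ∈ k.primeFactors, Real.log q ^ m)) := by rw [hsplit]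
    _ = Real.log p ^ (2 * m) * (copTauW n p * (copTauW (n * p) k * G (p * k))) +
          Real.log p ^ m * (copTauW n p * (copTauW (n * p) k * (G (p * k) * ∑ q ∈ k.primeFactors, Real.log q ^ m))) := by
        ring

end Summit.Parity.GeneralizedHardyLittlewood.Theorems.MomentsBeyondDiagonal.DiagLines

end
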